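import Literature.AnabelianGeometry.EtaleTheta.SettingModelCyclotomicCharacterInvariants
import HarnessLib

/-!
# The cyclotomic character `χ : G_{ℚ_p} → Aut(Ẑ)` is NON-TRIVIAL on every open subgroup (proof-only)

J. Neukirch, *Algebraic Number Theory*, Ch. II Prop. (5.7) (i) (finiteness of the roots of unity of a `p`-adic field, whence
`H⁰(U, Ẑ(1)) = 1` for open `U ≤ G_{ℚ_p}` — this seat's `SettingModelCyclotomicCharacterInvariants`)
[cite: NeukirchANT1999, Ch. II Prop. (5.7) (i)]; S. Mochizuki, [EtTh] §1 p. 12 «`Δ_Θ (≅ Ẑ(1))`» [cite: MochizukiEtTh2009, §1 p.12].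
abc-iut cell, layer L2, seat abc-iut-w5-d091 (gen 4); R78 cluster, file F3 addendum 2.  PROOF-ONLY (no definition, no
instance, no named fact).  Since `Ẑ ≠ 1` (`ZHatLevel.eta 1 ≠ 1`: its level-`2` shadow is `1 mod 2`) and `Ẑ(χ)` has no
invariants under an open subgroup, NO open subgroup of `G_{ℚ_p}` acts trivially through `χ`:

* `eta_one_ne_one` — `η(1) ≠ 1` in `Ẑ`;
* **`exists_mem_chi_ne_one_of_isOpen`** — for every OPEN `U ≤ G_{ℚ_p}` some `σ ∈ U` has `χ(σ) ≠ 1` (so `χ` has infinite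
  image: its kernel contains no open subgroup, `not_isOpen_ker_chi`);
* `exists_chi_ne_one`, `chi_ne_one` — in particular `χ ≠ 1`: at the χ-twisted model the conjugation action of `Π^tp` on
  `Δ_Θ ≅ Ẑ(χ)` is NON-TRIVIAL (at the root model it is trivial — the R77 emptiness mechanism).
Nothing of [EtTh] is asserted; no side is taken on [IUTchIII] Cor. 3.12; a model is consistency evidence only.
-/

noncomputable section

open CategoryTheory ProfiniteGrp ProfiniteGrp.ProfiniteCompletion

namespace Literature.AnabelianGeometry.EtaleTheta.SettingModel

open Literature.AnabelianGeometry.SemiGraphs (GQp)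

variable (p : ℕ) [Fact p.Prime]

/-- `η(1) ≠ 1` in `Ẑ` (its image in `ℤ/2ℤ` is `1 ≠ 0`). [cite: NeukirchANT1999, Ch. II Prop. (5.7) (i)] -/
theorem eta_one_ne_one : ZHatLevel.eta 1 ≠ (1 : completion (GrpCat.of (Multiplicative ℤ))) := by
  intro h
  have h2 := congrArg (fun x => Multiplicative.toAdd (ZHatLevel.level (2 : ℕ+) x)) h
  simp only [ZHatLevel.level_eta, map_one, toAdd_one, toAdd_ofAdd, Int.cast_one] at h2
  exact absurd h2 (by decide)

/-- **No open subgroup of `G_{ℚ_p}` acts trivially through `χ`**: for every open `U ≤ G_{ℚ_p}` there is `σ ∈ U` with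
`χ(σ) ≠ 1` (else `η(1) ∈ Ẑ(χ)^U = 1`). [cite: NeukirchANT1999, Ch. II Prop. (5.7) (i)] -/
theorem exists_mem_chi_ne_one_of_isOpen (U : Subgroup (GQp p)) (hU : IsOpen (U : Set (GQp p))) :
    ∃ σ ∈ U, chi p σ ≠ 1 := by
  by_contra h
  push Not at h
  exact eta_one_ne_one
    (eq_one_of_forall_chi_apply_eq_of_isOpen p U hU fun σ hσ => by rw [h σ hσ, MulAut.one_apply])

/-- Hence **the kernel of `χ` is not open** (`χ` has infinite image). [cite: NeukirchANT1999, Ch. II Prop. (5.7) (i)] -/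
theorem not_isOpen_ker_chi : ¬ IsOpen ((chi p).ker : Set (GQp p)) := fun h => by
  obtain ⟨σ, hσ, hne⟩ := exists_mem_chi_ne_one_of_isOpen p (chi p).ker h
  exact hne ((MonoidHom.mem_ker).mp hσ)

/-- **`χ(σ) ≠ 1` for some `σ ∈ G_{ℚ_p}`.** [cite: NeukirchANT1999, Ch. II Prop. (5.7) (i)] -/
theorem exists_chi_ne_one : ∃ σ : GQp p, chi p σ ≠ 1 := by
  obtain ⟨σ, -, hσ⟩ := exists_mem_chi_ne_one_of_isOpen p ⊤ (by simp)
  exact ⟨σ, hσ⟩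

/-- **The cyclotomic character `χ : G_{ℚ_p} → Aut(Ẑ)` is not the trivial homomorphism.**
[cite: NeukirchANT1999, Ch. II Prop. (5.7) (i)] -/
theorem chi_ne_one : chi p ≠ 1 := by
  obtain ⟨σ, hσ⟩ := exists_chi_ne_one p
  exact fun h => hσ (by rw [h, MonoidHom.one_apply])

end Literature.AnabelianGeometry.EtaleTheta.SettingModel

end
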